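import Mathlib
import Literature.Analysis.FluidPDE.VorticityEquation
import Literature.Analysis.FluidPDE.ESSUniqueContinuationHolds
import Literature.Analysis.FluidPDE.LocalTypeI
import Literature.Analysis.FluidPDE.KNSSThm52Integrand
import Literature.Analysis.FluidPDE.EnstrophySplitting
import Literature.Analysis.FluidPDE.ClassicalSolutionGalilean
import Literature.Analysis.FluidPDE.AxisymmetricVorticityTransport
import Summits.NavierStokesRegularity.NavierStokesRegularity.Theorems.RootDecompLitSliceDarkBallSpreadsRegularPointSmoothing
import Summits.NavierStokesRegularity.NavierStokesRegularity.Theorems.RootDecompLitSliceDarkBallSpreadsTerminalLimit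
import HarnessLib

/-!
# Route RootDecompLitSlice — brick B4-APPLICATION «LOCAL SPREAD FROM FLATNESS», part 1/2
  (the reversed vorticity), of the aside D₁
  `DarkBallSpreads` (stmt-NavierStokesRegularity-29566, the registered stub `stub_darkBallSpreads` of
  crux D `NoDarkBall` stmt-NavierStokesRegularity-29563)

THE LOCAL SPREAD STEP of the D₁ tail (hypothesis `hLS` of
`Theorems/RootDecompLitSliceDarkBallSpreadsAssemblyModuloLocalSpread.lean`, writer; `hstep` of
`curl_eq_zero_compl_backwardSingularSlice_of_darkBall`, PROPAGATION) from FLATNESS of the vorticity,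
by the landed unique continuation through spatial boundaries
`Literature.Analysis.FluidPDE.ess_unique_continuation_holds` (Escauriaza–Seregin–Šverák 2003,
Thm 4.1, smooth form, `m = 3`).

Setting: `ν, T > 0`, `(u, p)` classical on `[0, T)`, Leray–Hopf on `[0, T]` from a rapidly decaying
datum, `Σ_T = {x | IsBackwardSingularPoint u (T, x)}` the backward-singular terminal slice, `w` the
pointwise limit of `u t` on `Σ_Tᶜ` (brick B1′). For a regular `x₀` take brick B1's cylinder
`Q_r(T, x₀)` (`regularPoint_iteratedFDeriv_bounds`: all `Dⁿu` bounded and space–time Hölder there,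
`r² < T`) and `ρ := r/2`. For a regular `x₁` with `dist x₁ x₀ < r/2` suppose FLATNESS at `x₁`
(the output of brick B3, census): on some `(T − τ, T) × B(x₁, δ)` the vorticity satisfies
`‖curl u(t, x)‖ ≤ C_k (T − t)^k` for every `k`. Then `curl w = 0` on `B(x₁, r/2) ∋ x₀`:

* the REVERSED, TRANSLATED, VISCOSITY-NORMALISED vorticity
  `U(s, y) = curl u(T − s/ν, y + x₁)` for `s > 0`, `U(0, y) = curl w(y + x₁)`, lives on
  `(0, ν r²/4) × B(0, r/2)`, whose image lies in `Q_r(T, x₀)` (`rev_mem`), and `B(x₀, r) ⊆ Σ_Tᶜ`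
  (`not_isBackwardSingularPoint_of_mem_ball`: `u` is bounded on a backward cylinder at each point);
* (4.1)/(C²): `U` is jointly `C^∞` on the open cylinder (joint smoothness of the vorticity,
  `IsSmoothSpaceTimeOn.fderiv_slice` + `clm_comp curlCLM`, composed with the affine map), continuous
  up to `s = 0` (brick B1′'s derivative tower on `Q_r(T, x₀)`: `fderiv (u t) → fderiv w` uniformly on
  `B(x₀, r)`), and `U, ∇U, ∇²U, ∂ₛU` are bounded (B1's bounds on `Du, D²u, D³u` and the vorticity
  equation), so the `W^{2,1}_2` integral over the bounded cylinder is finite;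
* (4.2): `∂ₛU + ΔU = ν⁻¹((u·∇)ω − (ω·∇)u)` (vorticity equation
  `IsClassicalNSSolutionOn.isVorticitySolutionOn_zero_force`, chain rule in `s`, translation
  invariance of `Δ` and `fderiv`), whence `‖∂ₛU + ΔU‖ ≤ c₁ (‖U‖ + ‖∇U‖)`, `c₁ = (sup‖u‖ + sup‖∇u‖)/ν`;
* (4.3): `‖U(s, y)‖ ≤ C'_k (‖y‖ + √s)^k` from flatness near `x₁` for `s/ν < τ`, and from the
  boundedness of the vorticity on `Q_r(T, x₀)` off `B(0, δ)` or for `s ≥ ντ` (`rev_flat`).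

ESS Thm 4.1 gives `U(0, ·) = 0` on `B(0, r/2)`, i.e. `curl w = 0` on `B(x₁, r/2)`, a neighbourhood of
`x₀`. THIS FILE (part 1/2): the calculus of the reversed vorticity — `rev_mem` (cylinder inclusion),
`not_isBackwardSingularPoint_of_mem_ball` (regular ball), `rev_contDiffOn` (joint smoothness),
`rev_continuousOn` (continuity up to `s = 0`), `rev_hasDerivAt` / `rev_timeDeriv_add_laplacian`
((4.2) as an identity). Part 2/2 (`…LocalSpread.lean`): the bounds (4.1)/(4.3), the ESS
application and the main statement `localSpread_of_flatVorticity`.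

HONEST FRAMING: an application of a LANDED literature theorem to a HYPOTHETICAL singular time; closes
no item by itself; decorative for the summit per D-0179; nothing here bears on NS regularity (rung 0).
Lands `--supports stmt-NavierStokesRegularity-29566 --as helper` (decomp-ns route-writer g16). [folklore]
-/

noncomputable section

open MeasureTheory Set Function Filter Topology Metric
open scoped ENNReal NNReal ContDiff Laplacian
open Literature.Analysis.FluidPDE

-- the summit and its single sub-problem share the name (CONVENTIONS §1), as in every Theorems file
set_option linter.dupNamespace false

namespace Summit.NavierStokesRegularity.NavierStokesRegularity.Theorems

namespace DarkBallLocalSpread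

/-! ## §1 Calculus helpers on `ℝ³` -/

/-- `dist (curl v x) (curl v' x) ≤ ‖curlCLM‖ · dist (Dv x) (Dv' x)`. [folklore] -/
theorem dist_curl_le (v v' : EuclideanSpace ℝ (Fin 3) → EuclideanSpace ℝ (Fin 3))
    (x : EuclideanSpace ℝ (Fin 3)) :
    dist (curl v x) (curl v' x) ≤ ‖curlCLM‖ * dist (fderiv ℝ v x) (fderiv ℝ v' x) := by
  rw [curl_eq_curlCLM, curl_eq_curlCLM, dist_eq_norm, dist_eq_norm, ← map_sub]
  exact curlCLM.le_opNorm _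

/-- `‖v‖ ≤ M` gives `‖v‖ₑ² ≤ (ofReal M)²`. [folklore] -/
theorem enorm_sq_le_of_norm_le {F : Type*} [NormedAddCommGroup F] {v : F} {M : ℝ} (h : ‖v‖ ≤ M) :
    ‖v‖ₑ ^ 2 ≤ ENNReal.ofReal M ^ 2 := by
  rw [← ofReal_norm]
  gcongr

/-! ## §2 The regular ball and the reversed cylinder -/

/-- A point of the spatial ball of a backward cylinder on which `u` is bounded is NOT a backward
singular point (a small backward cylinder at it lies inside). [folklore] -/
theorem not_isBackwardSingularPoint_of_mem_ball {u : ℝ → EuclideanSpace ℝ (Fin 3) → EuclideanSpace ℝ (Fin 3)}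
    {T r K : ℝ} {x₀ x : EuclideanSpace ℝ (Fin 3)}
    (hK : ∀ z ∈ parabolicCylinder r ((T : ℝ), x₀), ‖u z.1 z.2‖ ≤ K) (hx : x ∈ ball x₀ r) :
    ¬ IsBackwardSingularPoint u ((T : ℝ), x) := by
  intro hsing
  set r' : ℝ := r - dist x x₀ with hr'_def
  have hr' : 0 < r' := by rw [mem_ball] at hx; linarith
  have hr'r : r' ≤ r := by linarith [dist_nonneg (x := x) (y := x₀)]
  have hsub : parabolicCylinder r' ((T : ℝ), x) ⊆ parabolicCylinder r ((T : ℝ), x₀) := by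
    intro z hz
    rw [mem_parabolicCylinder] at hz ⊢
    refine ⟨⟨?_, hz.1.2⟩, ?_⟩
    · have : r' ^ 2 ≤ r ^ 2 := pow_le_pow_left₀ hr'.le hr'r 2
      linarith [hz.1.1]
    · calc dist z.2 x₀ ≤ dist z.2 x + dist x x₀ := dist_triangle _ _ _
        _ < r' + dist x x₀ := by linarith [hz.2]
        _ = r := by rw [hr'_def]; ring
  have hfin : eLpNorm (uncurry u) (⊤ : ℝ≥0∞) (volume.restrict (parabolicCylinder r' ((T : ℝ), x))) < ⊤ := by
    rw [eLpNorm_exponent_top]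
    refine eLpNormEssSup_lt_top_of_ae_bound (C := K) (ae_restrict_of_forall_mem
      (isOpen_parabolicCylinder r' ((T : ℝ), x)).measurableSet fun z hz => ?_)
    exact hK z (hsub hz)
  exact hfin.ne (hsing r' hr')

/-- The reversed cylinder maps into B1's cylinder: for `0 < s < ν (r/2)²`, `‖y‖ < r/2` and
`dist x₁ x₀ < r/2`, the point `(T − s/ν, y + x₁)` lies in `Q_r(T, x₀)`, and `0 < T − s/ν < T`
(given `r² < T`). [folklore] -/
theorem rev_mem {ν T r : ℝ} (hν : 0 < ν) (hrT : r ^ 2 < T) {x₀ x₁ : EuclideanSpace ℝ (Fin 3)}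
    (hd : dist x₁ x₀ < r / 2) {s : ℝ} (hs : s ∈ Ioo 0 (ν * (r / 2) ^ 2))
    {y : EuclideanSpace ℝ (Fin 3)} (hy : y ∈ ball (0 : EuclideanSpace ℝ (Fin 3)) (r / 2)) :
    (T - s / ν, y + x₁) ∈ parabolicCylinder r ((T : ℝ), x₀) ∧ T - s / ν ∈ Ioo 0 T := by
  have h1 : 0 < s / ν := div_pos hs.1 hν
  have h2 : s / ν < (r / 2) ^ 2 := by rw [div_lt_iff₀ hν]; linarith [hs.2]
  have h3 : (r / 2) ^ 2 ≤ r ^ 2 := by nlinarith [sq_nonneg r]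
  refine ⟨?_, by linarith, by linarith⟩
  rw [mem_parabolicCylinder]
  refine ⟨⟨by linarith, by linarith⟩, ?_⟩
  calc dist (y + x₁) x₀ ≤ dist (y + x₁) x₁ + dist x₁ x₀ := dist_triangle _ _ _
    _ = ‖y‖ + dist x₁ x₀ := by rw [dist_eq_norm, add_sub_cancel_right]
    _ < r / 2 + r / 2 := add_lt_add (mem_ball_zero_iff.1 hy) hd
    _ = r := by ring

/-- Spatial part of `rev_mem`: `y + x₁ ∈ B(x₀, r)`. [folklore] -/
theorem rev_mem_ball {r : ℝ} {x₀ x₁ : EuclideanSpace ℝ (Fin 3)} (hd : dist x₁ x₀ < r / 2)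
    {y : EuclideanSpace ℝ (Fin 3)} (hy : y ∈ ball (0 : EuclideanSpace ℝ (Fin 3)) (r / 2)) :
    y + x₁ ∈ ball x₀ r := by
  rw [mem_ball]
  calc dist (y + x₁) x₀ ≤ dist (y + x₁) x₁ + dist x₁ x₀ := dist_triangle _ _ _
    _ = ‖y‖ + dist x₁ x₀ := by rw [dist_eq_norm, add_sub_cancel_right]
    _ < r / 2 + r / 2 := add_lt_add (mem_ball_zero_iff.1 hy) hd
    _ = r := by ring

/-! ## §3 The reversed vorticity: smoothness, continuity up to `s = 0`, time derivative -/

section Reversed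

variable {ν T r : ℝ} {u : ℝ → EuclideanSpace ℝ (Fin 3) → EuclideanSpace ℝ (Fin 3)}
  {p : ℝ → EuclideanSpace ℝ (Fin 3) → ℝ}
  {w : EuclideanSpace ℝ (Fin 3) → EuclideanSpace ℝ (Fin 3)} {x₀ x₁ : EuclideanSpace ℝ (Fin 3)}
  {U : ℝ → EuclideanSpace ℝ (Fin 3) → EuclideanSpace ℝ (Fin 3)}

/-- (C²) The reversed vorticity is jointly `C^∞` on the open reversed cylinder. [folklore] -/
theorem rev_contDiffOn (hν : 0 < ν) (hrT : r ^ 2 < T) (hsm : IsSmoothSpaceTimeOn (Ico 0 T) u)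
    (hd : dist x₁ x₀ < r / 2) (hU : ∀ s, 0 < s → ∀ y, U s y = curl (u (T - s / ν)) (y + x₁)) :
    ContDiffOn ℝ ∞ (uncurry U)
      (Ioo 0 (ν * (r / 2) ^ 2) ×ˢ ball (0 : EuclideanSpace ℝ (Fin 3)) (r / 2)) := by
  have hω : ContDiffOn ℝ ∞ (uncurry (vorticity u)) (Ico 0 T ×ˢ univ) :=
    hsm.isSmoothSpaceTimeOn_vorticity (uniqueDiffOn_Ico 0 T)
  have hΦ : ContDiff ℝ ∞ (fun z : ℝ × EuclideanSpace ℝ (Fin 3) =>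
      ((T - z.1 / ν, z.2 + x₁) : ℝ × EuclideanSpace ℝ (Fin 3))) :=
    (contDiff_const.sub (contDiff_fst.div_const ν)).prodMk (contDiff_snd.add contDiff_const)
  have hmaps : MapsTo (fun z : ℝ × EuclideanSpace ℝ (Fin 3) =>
      ((T - z.1 / ν, z.2 + x₁) : ℝ × EuclideanSpace ℝ (Fin 3)))
      (Ioo 0 (ν * (r / 2) ^ 2) ×ˢ ball (0 : EuclideanSpace ℝ (Fin 3)) (r / 2)) (Ico 0 T ×ˢ univ) :=
    fun z hz => ⟨Ioo_subset_Ico_self (rev_mem hν hrT hd hz.1 hz.2).2, mem_univ _⟩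
  refine (hω.comp hΦ.contDiffOn hmaps).congr ?_
  rintro ⟨s, y⟩ hz
  simp only [Function.comp_apply, uncurry_apply_pair, vorticity_apply]
  exact hU s hz.1.1 y

/-- (continuity up to `s = 0`) If `D(u t) → Dw` uniformly on `B(x₀, r)` as `t → T⁻` and `curl w` is
continuous there, the reversed vorticity extended by `curl w(· + x₁)` at `s = 0` is continuous on
`[0, ν r²/4) × B(0, r/2)`. [folklore] -/
theorem rev_continuousOn (hν : 0 < ν) (hrT : r ^ 2 < T) (hsm : IsSmoothSpaceTimeOn (Ico 0 T) u)
    (hd : dist x₁ x₀ < r / 2) (hWc : ContinuousOn (fun x => curl w x) (ball x₀ r))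
    (hconv : TendstoUniformlyOn (fun t => fderiv ℝ (u t)) (fderiv ℝ w) (𝓝[<] T) (ball x₀ r))
    (hU : ∀ s, 0 < s → ∀ y, U s y = curl (u (T - s / ν)) (y + x₁))
    (hU0 : ∀ y, U 0 y = curl w (y + x₁)) :
    ContinuousOn (uncurry U)
      (Ico 0 (ν * (r / 2) ^ 2) ×ˢ ball (0 : EuclideanSpace ℝ (Fin 3)) (r / 2)) := by
  rintro ⟨s, y⟩ ⟨hs, hy⟩
  rcases hs.1.eq_or_lt with rfl | hs0
  · -- the slice `s = 0`
    have hxy : y + x₁ ∈ ball x₀ r := rev_mem_ball hd hy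
    rw [Metric.continuousWithinAt_iff]
    intro ε hε
    -- uniform closeness of `curl (u t)` to `curl w` on `B(x₀, r)` for `t` near `T`
    set ε₁ : ℝ := ε / 2 / (‖curlCLM‖ + 1) with hε₁_def
    have hL : 0 < ‖curlCLM‖ + 1 := by positivity
    have hε₁ : 0 < ε₁ := by positivity
    have hev : ∀ᶠ t in 𝓝[<] T, ∀ x ∈ ball x₀ r, dist (fderiv ℝ w x) (fderiv ℝ (u t) x) < ε₁ :=
      (Metric.tendstoUniformlyOn_iff.1 hconv) ε₁ hε₁
    obtain ⟨l, hlT, hl⟩ := (mem_nhdsLT_iff_exists_Ioo_subset).1 hev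
    rw [mem_Iio] at hlT
    -- continuity of `curl w` at `y + x₁`
    have hcont : ContinuousAt (fun x => curl w x) (y + x₁) :=
      hWc.continuousAt (isOpen_ball.mem_nhds hxy)
    obtain ⟨η, hη, hηc⟩ := Metric.continuousAt_iff.1 hcont (ε / 2) (by positivity)
    refine ⟨min (ν * (T - l)) η, lt_min (mul_pos hν (by linarith)) hη, ?_⟩
    rintro ⟨s', y'⟩ ⟨hs', hy'⟩ hdist
    rw [Prod.dist_eq, max_lt_iff] at hdist
    obtain ⟨hds, hdy⟩ := hdist
    have hds' : |s'| < ν * (T - l) := lt_of_lt_of_le (by simpa [Real.dist_eq] using hds) (min_le_left _ _)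
    have hdy' : dist y' y < η := lt_of_lt_of_le hdy (min_le_right _ _)
    have hclose : dist (curl w (y' + x₁)) (curl w (y + x₁)) < ε / 2 :=
      hηc (by simpa [dist_eq_norm] using hdy')
    simp only [uncurry_apply_pair]
    rw [hU0 y]
    rcases hs'.1.eq_or_lt with rfl | hs'0
    · rw [hU0 y']
      linarith
    · rw [hU s' hs'0 y']
      have hs'abs : s' < ν * (T - l) := by rwa [abs_of_pos hs'0] at hds'
      have ht' : T - s' / ν ∈ Ioo l T := by
        constructor
        · have : s' / ν < T - l := by rw [div_lt_iff₀ hν]; linarith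
          linarith
        · have : 0 < s' / ν := div_pos hs'0 hν
          linarith
      have hxy' : y' + x₁ ∈ ball x₀ r := rev_mem_ball hd hy'
      have h1 : dist (curl (u (T - s' / ν)) (y' + x₁)) (curl w (y' + x₁)) ≤ ε / 2 := by
        refine (dist_curl_le _ _ _).trans ?_
        have h2 : dist (fderiv ℝ (u (T - s' / ν)) (y' + x₁)) (fderiv ℝ w (y' + x₁)) < ε₁ := by
          rw [dist_comm]; exact hl ht' (y' + x₁) hxy'
        calc ‖curlCLM‖ * dist (fderiv ℝ (u (T - s' / ν)) (y' + x₁)) (fderiv ℝ w (y' + x₁))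
            ≤ ‖curlCLM‖ * ε₁ := by gcongr
          _ ≤ (‖curlCLM‖ + 1) * ε₁ := by gcongr; linarith
          _ = ε / 2 := by rw [hε₁_def]; field_simp
      calc dist (curl (u (T - s' / ν)) (y' + x₁)) (curl w (y + x₁))
          ≤ dist (curl (u (T - s' / ν)) (y' + x₁)) (curl w (y' + x₁)) +
              dist (curl w (y' + x₁)) (curl w (y + x₁)) := dist_triangle _ _ _
        _ < ε / 2 + ε / 2 := add_lt_add_of_le_of_lt h1 hclose
        _ = ε := by ring
  · -- interior point: joint smoothness
    have h1 := (rev_contDiffOn hν hrT hsm hd hU).continuousOn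
    have hmem : ((s, y) : ℝ × EuclideanSpace ℝ (Fin 3)) ∈
        Ioo 0 (ν * (r / 2) ^ 2) ×ˢ ball (0 : EuclideanSpace ℝ (Fin 3)) (r / 2) := ⟨⟨hs0, hs.2⟩, hy⟩
    exact (h1.continuousAt ((isOpen_Ioo.prod isOpen_ball).mem_nhds hmem)).continuousWithinAt

/-- (time derivative) For `0 < s < ν r²/4`: `∂ₛU(s, y) = −ν⁻¹ ∂ₜω(T − s/ν, y + x₁)`, the one-sided
time derivative of the vorticity within `[0, T)` (chain rule; `[0, T)` is a neighbourhood of the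
interior time). [folklore] -/
theorem rev_hasDerivAt (hν : 0 < ν) (hrT : r ^ 2 < T) (hsm : IsSmoothSpaceTimeOn (Ico 0 T) u)
    (hd : dist x₁ x₀ < r / 2) (hU : ∀ s, 0 < s → ∀ y, U s y = curl (u (T - s / ν)) (y + x₁))
    {s : ℝ} (hs : s ∈ Ioo 0 (ν * (r / 2) ^ 2)) {y : EuclideanSpace ℝ (Fin 3)}
    (hy : y ∈ ball (0 : EuclideanSpace ℝ (Fin 3)) (r / 2)) :
    HasDerivAt (fun σ => U σ y)
      ((-(1 / ν)) • timeDerivWithin (Ico 0 T) (vorticity u) (T - s / ν) (y + x₁)) s := by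
  have ht := (rev_mem hν hrT hd hs hy).2
  have hω := hsm.isSmoothSpaceTimeOn_vorticity (uniqueDiffOn_Ico 0 T)
  have h1 : HasDerivWithinAt (fun σ => vorticity u σ (y + x₁))
      (timeDerivWithin (Ico 0 T) (vorticity u) (T - s / ν) (y + x₁)) (Ico 0 T) (T - s / ν) :=
    hω.hasDerivWithinAt_timeDerivWithin (uniqueDiffOn_Ico 0 T) (Ioo_subset_Ico_self ht) (y + x₁)
  have h2 : HasDerivAt (fun σ => vorticity u σ (y + x₁))
      (timeDerivWithin (Ico 0 T) (vorticity u) (T - s / ν) (y + x₁)) (T - s / ν) :=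
    h1.hasDerivAt (mem_of_superset (Ioo_mem_nhds ht.1 ht.2) Ioo_subset_Ico_self)
  have h3 : HasDerivAt (fun σ : ℝ => T - σ / ν) (-(1 / ν)) s := by
    simpa using ((hasDerivAt_id s).div_const ν).const_sub T
  have h4 := h2.scomp s h3
  refine h4.congr_of_eventuallyEq ?_
  filter_upwards [Ioi_mem_nhds hs.1] with σ hσ
  simp only [Function.comp_apply, vorticity_apply]
  exact hU σ hσ y

/-- The slice `U s = curl u(T − s/ν, · + x₁)` for `s > 0`, as functions. [folklore] -/
theorem rev_slice_eq (hU : ∀ s, 0 < s → ∀ y, U s y = curl (u (T - s / ν)) (y + x₁)) {s : ℝ}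
    (hs : 0 < s) : U s = fun y => curl (u (T - s / ν)) (y + x₁) :=
  funext fun y => hU s hs y

/-- (4.2, pointwise identity) For `0 < s < ν r²/4`, `‖y‖ < r/2`, with `t = T − s/ν`, `x = y + x₁`,
`ω = curl u`: `∂ₛU + ΔU = ν⁻¹ ((u·∇)ω − (ω·∇)u)(t, x)` — the vorticity equation read backwards. [folklore] -/
theorem rev_timeDeriv_add_laplacian (hν : 0 < ν) (hT : 0 < T) (hrT : r ^ 2 < T)
    (hsol : IsClassicalNSSolutionOn (Ico 0 T) ν 0 u p) (hd : dist x₁ x₀ < r / 2)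
    (hU : ∀ s, 0 < s → ∀ y, U s y = curl (u (T - s / ν)) (y + x₁))
    {s : ℝ} (hs : s ∈ Ioo 0 (ν * (r / 2) ^ 2)) {y : EuclideanSpace ℝ (Fin 3)}
    (hy : y ∈ ball (0 : EuclideanSpace ℝ (Fin 3)) (r / 2)) :
    timeDeriv U s y + (Δ (U s)) y =
      (1 / ν) • (convect (u (T - s / ν)) (curl (u (T - s / ν))) (y + x₁) -
        convect (curl (u (T - s / ν))) (u (T - s / ν)) (y + x₁)) := by
  have ht := (rev_mem hν hrT hd hs hy).2
  have hcl : Ico 0 T ⊆ closure (interior (Ico 0 T)) := by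
    rw [interior_Ico, closure_Ioo hT.ne]; exact Ico_subset_Icc_self
  have hVS := hsol.isVorticitySolutionOn_zero_force (uniqueDiffOn_Ico 0 T) hcl
  have hveq := hVS.vorticity_eq (T - s / ν) (Ioo_subset_Ico_self ht) (y + x₁)
  simp only [vorticity_apply] at hveq
  -- the time derivative
  have hD : timeDeriv U s y =
      (-(1 / ν)) • timeDerivWithin (Ico 0 T) (vorticity u) (T - s / ν) (y + x₁) := by
    rw [timeDeriv_apply]
    exact (rev_hasDerivAt hν hrT hsol.smooth_velocity hd hU hs hy).deriv
  have hD' : timeDerivWithin (Ico 0 T) (vorticity u) (T - s / ν) (y + x₁) =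
      convect (curl (u (T - s / ν))) (u (T - s / ν)) (y + x₁) +
        ν • (Δ (curl (u (T - s / ν)))) (y + x₁) -
        convect (u (T - s / ν)) (curl (u (T - s / ν))) (y + x₁) := by
    rw [← hveq]; abel
  -- the Laplacian of the translated slice
  have hL : (Δ (U s)) y = (Δ (curl (u (T - s / ν)))) (y + x₁) := by
    rw [rev_slice_eq hU hs.1, laplacian_comp_add_right]
  rw [hD, hD', hL]
  set A := convect (curl (u (T - s / ν))) (u (T - s / ν)) (y + x₁)
  set B := convect (u (T - s / ν)) (curl (u (T - s / ν))) (y + x₁)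
  set L := (Δ (curl (u (T - s / ν)))) (y + x₁)
  have hνne : ν ≠ 0 := hν.ne'
  calc -(1 / ν) • (A + ν • L - B) + L = -(1 / ν) • (A - B) + (-(1 / ν) • (ν • L) + L) := by
        rw [show A + ν • L - B = (A - B) + ν • L by abel, smul_add, add_assoc]
    _ = -(1 / ν) • (A - B) := by
        rw [smul_smul, show -(1 / ν) * ν = -1 by field_simp, neg_one_smul, neg_add_cancel, add_zero]
    _ = (1 / ν) • (B - A) := by rw [neg_smul, ← smul_neg, neg_sub]

end Reversed

end DarkBallLocalSpread

end Summit.NavierStokesRegularity.NavierStokesRegularity.Theorems
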